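import Literature.NumberTheory.GaloisRepresentations.PicardLambdaAdicRepLocal
import HarnessLib

/-!
# The `λ`-adic representation of a Picard curve from DIVISIBILITY of the Jacobian, good reduction
# and the twisted Lefschetz formula

Topic `Literature/NumberTheory/GaloisRepresentations` (Upton 2009; continues `PicardLambdaAdicRepLocal`).
The tree's conditional theorem `picardCurve_exists_lambdaAdicRep_of_torsion_goodReduction_lefschetz`
derives `picardCurve_exists_lambdaAdicRep` from three classical inputs `hX1`, `hX2`, `hX3`, the first
being the full torsion structure `Cl(F/M)[N] ≅ (ℤ/N)^{2g}` of the divisor class group of EVERY function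
field over an algebraically closed constant field (Rosen, Cor. to Thm. 11.12 = Weil's theorem on the
dimension and the torsion of the Jacobian).  Here that input is replaced by the strictly weaker and more
basic first clause of Rosen's Thm. 11.12,

* `hX1'` — **`Cl⁰(F/M)` is a divisible group** for `M` algebraically closed (Rosen Thm. 11.12 (i);
  Mumford, *Abelian Varieties* §6 Application 2: `n_X` is an isogeny, so `X(k)` is divisible),
  used only for `N` prime to the characteristic and only for the ONE function field `K̄(C_f)`;

the rank `6` of `T₃ J(C_f)` being recovered from the count `#J_f[1 - ω] = 27` already in the tree
(`picard_card_geomLambdaTorsion`, Schaefer–Zarhin):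

* `geomPic_card_torsionBy_three_eq_sq` — for `y³ = f(x)`, `3 ∤ deg f`, over `K̄ ∋ ζ₃`: if `Pic⁰` is `3`-divisible
  then `#Pic[3] = (#J[λ])²` (`λ = 1 - δ`, `λ² = -3δ` on `Pic⁰` by the norm relation `1 + δ + δ² = 0`, so
  `Pic[3] = ker λ² ∩ Pic⁰` and `λ : ker λ² ↠ ker λ = J[λ]`);
* `geomPic_card_torsionBy_pow_of_divisible` — then `#Pic[3ⁿ] = (#J[λ])^{2n}` (dévissage along `3 • : Pic[3ⁿ⁺¹] ↠ Pic[3ⁿ]`);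
* `picard_hcard_of_divisible` — for the Picard curve `#J_f[3ⁿ] = 3^{6n}`;
* `card_torsionBy_reduction_eq` — the special fibre has the same counts, by the bijectivity on
  prime-to-`𝔭` torsion of the good-reduction datum `hX2` (so `hX1` is not needed there either);
* `picard_trace_frob_deck_of_card`, `trace_dual_picardRho1_frob_inv_of_card` — the Frobenius-trace
  computation of `PicardLambdaAdicRepLocal` run from the counts instead of `hX1`, concluded on `ρ = ρ₁^∨`;
* **`picardCurve_exists_lambdaAdicRep_of_card_goodReduction_lefschetz`** (input: the counts
  `#J_f[3ⁿ] = 3^{6n}` for the Picard curves over `K̄`, `K ⊇ ℚ(ω)`) and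
  **`picardCurve_exists_lambdaAdicRep_of_divisible_goodReduction_lefschetz hX1' hX2 hX3`**.

So `picardCurve_exists_lambdaAdicRep` is proved in the tree modulo: divisibility of `Cl⁰` over an
algebraically closed field (Rosen 11.12 (i)), the good-reduction datum for `y^p = f(x)` (Serre–Tate §1
Lemma 2 / Thm. 1, Deuring) and the twisted Lefschetz trace formula (Milne JV §11 Prop. 11.2) — the
inputs stay explicit hypotheses, not named facts.

## References
* C. Upton, *Galois representations attached to Picard curves*, J. Algebra 322 (2009), Thm. 2.1, §4. [Upton2009]
* M. Rosen, *Number Theory in Function Fields*, GTM 210 (2002), Ch. 11, Thm. 11.12. [RosenFunctionFields2002]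
* D. Mumford, *Abelian Varieties* (1970), §6 Application 2. [MumfordAV1970]
* J.-P. Serre, J. Tate, *Good reduction of abelian varieties*, Ann. Math. 88 (1968), §1. [SerreTate1968GoodReduction]
* J. S. Milne, *Jacobian varieties*, in Cornell–Silverman (1986), §11 Prop. 11.2. [Milne1986JacobianVarieties]
-/

noncomputable section

open Polynomial

namespace Literature.NumberTheory.GaloisRepresentations

open Literature.NumberTheory.EllipticCurves Literature.NumberTheory.DiophantineGeometry
  Literature.NumberTheory.DiophantineGeometry.AlgFunctionField Field IsDedekindDomain
open scoped NumberField Pointwise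

attribute [local instance] Ideal.Quotient.field

set_option synthInstance.maxHeartbeats 160000

/-! ### Divisibility of `Pic⁰` ⇒ `#Pic[3ⁿ] = (#J[λ])^{2n}` for `y³ = f(x)`, `3 ∤ deg f`, over `K̄` -/

section Divisible

universe u

variable {K : Type u} [Field K] {f : K[X]} [Fact (Irreducible (superellipticPoly K (AlgebraicClosure K) 3 f))]
  {ζ : K}

attribute [local instance] Finsupp.comapSMul Finsupp.comapMulAction Finsupp.comapDistribMulAction in
/-- The deck group preserves degrees on `Pic(C_{f,K̄})` (all places of `K̄(C_f)/K̄` are rational). [folklore] -/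
theorem geomPic_degree_deck_smul (ξ : CyclicCoverDeck (AlgebraicClosure K) 3) (c : GeomPic K 3 f) :
    SuperellipticPic.degree K (AlgebraicClosure K) 3 f (ξ • c) = SuperellipticPic.degree K (AlgebraicClosure K) 3 f c := by
  obtain ⟨D, rfl⟩ := SuperellipticPic.mk_surjective c
  rw [SuperellipticPic.deck_smul_mk, SuperellipticPic.degree_mk, SuperellipticPic.degree_mk]
  induction D using Finsupp.induction with
  | zero => rw [smul_zero]
  | single_add v n D _ _ ih =>
    have h1 : (ξ • v).degree = 1 := PlaceOver.isRational_of_isAlgClosed _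
    have h2 : v.degree = 1 := PlaceOver.isRational_of_isAlgClosed _
    rw [smul_add, map_add, map_add, ih, Finsupp.comapSMul_single, Divisor.degree_single, Divisor.degree_single, h1, h2]

/-- `δ³ = 1` for the deck generator. [folklore] -/
theorem deckGen_pow_three (hζ : IsPrimitiveRoot ζ 3) : deckGen hζ ^ 3 = 1 :=
  CyclicCoverDeck.ofRoot_pow_eq_one _

/-- `λ` commutes with the powers of `δ`: `λ (δʲ • c) = δʲ • λ c`. [folklore] -/
theorem lamAddMonoidHom_deckGen_pow_smul (hζ : IsPrimitiveRoot ζ 3) (j : ℕ) (c : GeomPic K 3 f) :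
    lamAddMonoidHom hζ (deckGen hζ ^ j • c) = deckGen hζ ^ j • lamAddMonoidHom hζ c := by
  rw [lamAddMonoidHom_apply, lamAddMonoidHom_apply, smul_sub, smul_smul, smul_smul, (Commute.self_pow (deckGen hζ) j).eq]

/-- `deg (λ c) = 0`: `λ = 1 - δ` kills degrees. [folklore] -/
theorem degree_lamAddMonoidHom_eq_zero (hζ : IsPrimitiveRoot ζ 3) (c : GeomPic K 3 f) :
    SuperellipticPic.degree K (AlgebraicClosure K) 3 f (lamAddMonoidHom hζ c) = 0 := by
  rw [lamAddMonoidHom_apply, map_sub, geomPic_degree_deck_smul, sub_self]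

/-- **`λ² = -3δ` on `Pic⁰`**: for a degree-zero class `c`, `λ(λ c) = -(3 • δ c)` — the norm relation
`1 + δ + δ² = 0` on `J(C_f)` (`sum_deck_pow_smul_eq_zero_of_degree_eq_zero`; in `ℤ[ω]`,
`(1 - ω)² = -3ω`). [cite: Zarhin2018SuperellipticJacobians, §8] [cite: Schaefer1998, §3] -/
theorem lamAddMonoidHom_lamAddMonoidHom_of_degree_eq_zero (hζ : IsPrimitiveRoot ζ 3) (hsep : f.Separable)
    (hndvd : ¬ 3 ∣ f.natDegree) {c : GeomPic K 3 f}
    (hc : SuperellipticPic.degree K (AlgebraicClosure K) 3 f c = 0) :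
    lamAddMonoidHom hζ (lamAddMonoidHom hζ c) = -(3 • (deckGen hζ • c)) := by
  have h := SuperellipticFunctionField.sum_deck_pow_smul_eq_zero_of_degree_eq_zero (K := K)
    (isPrimitiveRoot_algebraMap_algebraicClosure hζ) hsep hndvd hc
  rw [Finset.sum_range_succ, Finset.sum_range_succ, Finset.sum_range_one, pow_zero, one_smul, pow_one,
    sq, mul_smul] at h
  change c + deckGen hζ • c + deckGen hζ • deckGen hζ • c = 0 at h
  rw [lamAddMonoidHom_apply, lamAddMonoidHom_apply, smul_sub, ← sub_eq_zero, ← h]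
  abel

/-- **`3 • c = λ(λ(-(δ² c)))` on `Pic⁰`** (`3 = -ω²λ²` in `ℤ[ω]`, `δ³ = 1`). [cite: Zarhin2018SuperellipticJacobians, §8] -/
theorem three_smul_eq_lamAddMonoidHom_lamAddMonoidHom (hζ : IsPrimitiveRoot ζ 3) (hsep : f.Separable)
    (hndvd : ¬ 3 ∣ f.natDegree) {c : GeomPic K 3 f}
    (hc : SuperellipticPic.degree K (AlgebraicClosure K) 3 f c = 0) :
    (3 • c : GeomPic K 3 f) = lamAddMonoidHom hζ (lamAddMonoidHom hζ (-(deckGen hζ ^ 2 • c))) := by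
  have hc' : SuperellipticPic.degree K (AlgebraicClosure K) 3 f (-(deckGen hζ ^ 2 • c)) = 0 := by
    rw [map_neg, geomPic_degree_deck_smul, hc, neg_zero]
  have hδ3 : deckGen hζ * deckGen hζ ^ 2 = 1 := by rw [← pow_succ']; exact deckGen_pow_three hζ
  rw [lamAddMonoidHom_lamAddMonoidHom_of_degree_eq_zero hζ hsep hndvd hc', smul_neg, smul_neg, neg_neg, smul_smul,
    hδ3, one_smul]

/-- **`λ`-divisibility of `Pic⁰` from `3`-divisibility**: if every degree-zero class is `3 • c'` then
every degree-zero class is `λ c''` with `deg c'' = 0`. [cite: RosenFunctionFields2002, Ch. 11, Thm. 11.12] -/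
theorem exists_lamAddMonoidHom_eq_of_divisible (hζ : IsPrimitiveRoot ζ 3) (hsep : f.Separable)
    (hndvd : ¬ 3 ∣ f.natDegree)
    (hdiv : ∀ c : GeomPic K 3 f, SuperellipticPic.degree K (AlgebraicClosure K) 3 f c = 0 →
      ∃ c' : GeomPic K 3 f, 3 • c' = c)
    {c : GeomPic K 3 f} (hc : SuperellipticPic.degree K (AlgebraicClosure K) 3 f c = 0) :
    ∃ c'' : GeomPic K 3 f, SuperellipticPic.degree K (AlgebraicClosure K) 3 f c'' = 0 ∧ lamAddMonoidHom hζ c'' = c := by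
  obtain ⟨c', hc'⟩ := hdiv c hc
  have hdeg' : SuperellipticPic.degree K (AlgebraicClosure K) 3 f c' = 0 := by
    have h := congrArg (SuperellipticPic.degree K (AlgebraicClosure K) 3 f) hc'
    rw [map_nsmul, hc, nsmul_eq_mul, Nat.cast_ofNat, mul_eq_zero] at h
    exact h.resolve_left (by norm_num)
  refine ⟨lamAddMonoidHom hζ (-(deckGen hζ ^ 2 • c')), degree_lamAddMonoidHom_eq_zero hζ _, ?_⟩
  rw [← three_smul_eq_lamAddMonoidHom_lamAddMonoidHom hζ hsep hndvd hdeg', hc']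

/-- **`Pic[3] = Pic⁰ ∩ ker λ²`**: `3 • c = 0 ↔ deg c = 0 ∧ λ(λ c) = 0` (`λ² = -3δ`, `δ` invertible).
[cite: Zarhin2018SuperellipticJacobians, §8] -/
theorem geomPic_three_smul_eq_zero_iff (hζ : IsPrimitiveRoot ζ 3) (hsep : f.Separable) (hndvd : ¬ 3 ∣ f.natDegree)
    (c : GeomPic K 3 f) :
    (3 • c : GeomPic K 3 f) = 0 ↔
      SuperellipticPic.degree K (AlgebraicClosure K) 3 f c = 0 ∧ lamAddMonoidHom hζ (lamAddMonoidHom hζ c) = 0 := by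
  constructor
  · intro h3
    have hdeg : SuperellipticPic.degree K (AlgebraicClosure K) 3 f c = 0 :=
      jacobianTorsion_le_degreeZero K (AlgebraicClosure K) 3 f three_ne_zero
        (AddSubgroup.torsionBy.nsmul_iff.2 h3)
    refine ⟨hdeg, ?_⟩
    rw [lamAddMonoidHom_lamAddMonoidHom_of_degree_eq_zero hζ hsep hndvd hdeg, smul_comm, h3, smul_zero, neg_zero]
  · rintro ⟨hdeg, hll⟩
    rw [three_smul_eq_lamAddMonoidHom_lamAddMonoidHom hζ hsep hndvd hdeg, map_neg, map_neg,
      lamAddMonoidHom_deckGen_pow_smul, lamAddMonoidHom_deckGen_pow_smul, hll, smul_zero, neg_zero]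

/-- `λ` maps `Pic[3]` into `J[λ]`. [folklore] -/
theorem lamAddMonoidHom_mem_geomLambdaTorsion (hζ : IsPrimitiveRoot ζ 3) (hsep : f.Separable)
    (hndvd : ¬ 3 ∣ f.natDegree) {c : GeomPic K 3 f} (hc : c ∈ AddSubgroup.torsionBy (GeomPic K 3 f) (3 : ℕ)) :
    lamAddMonoidHom hζ c ∈ geomLambdaTorsion K 3 f := by
  rw [mem_geomLambdaTorsion_iff hζ hsep hndvd]
  have h3 : (3 • c : GeomPic K 3 f) = 0 := AddSubgroup.torsionBy.nsmul_iff.1 hc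
  refine ⟨AddSubgroup.torsionBy.nsmul_iff.2 ?_, ((geomPic_three_smul_eq_zero_iff hζ hsep hndvd c).1 h3).2⟩
  rw [← map_nsmul, h3, map_zero]

/-- **`#Pic[3] = (#J[λ])²`** when `Pic⁰` is `3`-divisible: `λ : Pic[3] → J[λ]` is onto (`λ`-divisibility)
with kernel `Pic[3] ∩ ker λ = J[λ]`. [cite: Zarhin2018SuperellipticJacobians, §8]
[cite: RosenFunctionFields2002, Ch. 11, Thm. 11.12] -/
theorem geomPic_card_torsionBy_three_eq_sq (hζ : IsPrimitiveRoot ζ 3) (hsep : f.Separable) (hndvd : ¬ 3 ∣ f.natDegree)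
    (hdiv : ∀ c : GeomPic K 3 f, SuperellipticPic.degree K (AlgebraicClosure K) 3 f c = 0 →
      ∃ c' : GeomPic K 3 f, 3 • c' = c) :
    Nat.card (AddSubgroup.torsionBy (GeomPic K 3 f) (3 : ℕ)) = Nat.card (geomLambdaTorsion K 3 f) ^ 2 := by
  classical
  set A₃ : AddSubgroup (GeomPic K 3 f) := AddSubgroup.torsionBy (GeomPic K 3 f) (3 : ℕ) with hA₃
  set ψ : A₃ →+ GeomPic K 3 f := (lamAddMonoidHom hζ).comp A₃.subtype with hψ
  -- range `= J[λ]`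
  have hrange : ψ.range = geomLambdaTorsion K 3 f := by
    apply le_antisymm
    · rintro _ ⟨⟨c, hc⟩, rfl⟩
      exact lamAddMonoidHom_mem_geomLambdaTorsion hζ hsep hndvd hc
    · intro x hx
      have hx' := (mem_geomLambdaTorsion_iff hζ hsep hndvd x).1 hx
      have hdeg : SuperellipticPic.degree K (AlgebraicClosure K) 3 f x = 0 :=
        jacobianTorsion_le_degreeZero K (AlgebraicClosure K) 3 f three_ne_zero hx'.1
      obtain ⟨y, hydeg, rfl⟩ := exists_lamAddMonoidHom_eq_of_divisible hζ hsep hndvd hdiv hdeg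
      have hy3 : (3 • y : GeomPic K 3 f) = 0 := (geomPic_three_smul_eq_zero_iff hζ hsep hndvd y).2 ⟨hydeg, hx'.2⟩
      exact ⟨⟨y, AddSubgroup.torsionBy.nsmul_iff.2 hy3⟩, rfl⟩
  -- kernel `≅ J[λ]`
  have hle : geomLambdaTorsion K 3 f ≤ A₃ := fun x hx => ((mem_geomLambdaTorsion_iff hζ hsep hndvd x).1 hx).1
  have hker : ψ.ker = (geomLambdaTorsion K 3 f).addSubgroupOf A₃ := by
    ext ⟨x, hx⟩
    rw [AddMonoidHom.mem_ker, AddSubgroup.mem_addSubgroupOf, hψ, AddMonoidHom.comp_apply, AddSubgroup.coe_subtype,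
      mem_geomLambdaTorsion_iff hζ hsep hndvd]
    exact ⟨fun h => ⟨hx, h⟩, fun h => h.2⟩
  have h := AddSubgroup.card_mul_index ψ.ker
  rw [AddSubgroup.index_ker, hrange, hker, Nat.card_congr (AddSubgroup.addSubgroupOfEquivOfLe hle).toEquiv] at h
  rw [← h, sq]

/-- **`#Pic[3ⁿ⁺¹] = #Pic[3ⁿ] · #Pic[3]`** when `Pic⁰` is `3`-divisible: `3 • : Pic[3ⁿ⁺¹] → Pic[3ⁿ]` is onto
with kernel `Pic[3]`. [cite: RosenFunctionFields2002, Ch. 11, Thm. 11.12] -/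
theorem geomPic_card_torsionBy_pow_succ_of_divisible (hdiv : ∀ c : GeomPic K 3 f, SuperellipticPic.degree K (AlgebraicClosure K) 3 f c = 0 →
      ∃ c' : GeomPic K 3 f, 3 • c' = c) (n : ℕ) :
    Nat.card (AddSubgroup.torsionBy (GeomPic K 3 f) (3 ^ (n + 1) : ℕ)) =
      Nat.card (AddSubgroup.torsionBy (GeomPic K 3 f) (3 ^ n : ℕ)) *
        Nat.card (AddSubgroup.torsionBy (GeomPic K 3 f) (3 : ℕ)) := by
  classical
  set A : AddSubgroup (GeomPic K 3 f) := AddSubgroup.torsionBy (GeomPic K 3 f) (3 ^ (n + 1) : ℕ) with hA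
  set ψ : A →+ GeomPic K 3 f := (nsmulAddMonoidHom 3 : GeomPic K 3 f →+ GeomPic K 3 f).comp A.subtype with hψ
  have hψapply : ∀ x : A, ψ x = 3 • (x : GeomPic K 3 f) := fun x => rfl
  -- range `= Pic[3ⁿ]`
  have hrange : ψ.range = AddSubgroup.torsionBy (GeomPic K 3 f) (3 ^ n : ℕ) := by
    apply le_antisymm
    · rintro _ ⟨⟨c, hc⟩, rfl⟩
      refine AddSubgroup.torsionBy.nsmul_iff.2 ?_
      rw [hψapply, ← mul_smul, ← pow_succ]
      exact AddSubgroup.torsionBy.nsmul_iff.1 hc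
    · intro x hx
      have hx' : (3 ^ n • x : GeomPic K 3 f) = 0 := AddSubgroup.torsionBy.nsmul_iff.1 hx
      have hdeg : SuperellipticPic.degree K (AlgebraicClosure K) 3 f x = 0 :=
        jacobianTorsion_le_degreeZero K (AlgebraicClosure K) 3 f (pow_ne_zero n three_ne_zero) hx
      obtain ⟨y, rfl⟩ := hdiv x hdeg
      refine ⟨⟨y, AddSubgroup.torsionBy.nsmul_iff.2 ?_⟩, rfl⟩
      rw [pow_succ, mul_smul, hx']
  -- kernel `≅ Pic[3]`
  have hle : AddSubgroup.torsionBy (GeomPic K 3 f) (3 : ℕ) ≤ A := fun x hx => by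
    refine AddSubgroup.torsionBy.nsmul_iff.2 ?_
    rw [pow_succ, mul_smul, AddSubgroup.torsionBy.nsmul_iff.1 hx, smul_zero]
  have hker : ψ.ker = (AddSubgroup.torsionBy (GeomPic K 3 f) (3 : ℕ)).addSubgroupOf A := by
    ext ⟨x, hx⟩
    rw [AddMonoidHom.mem_ker, AddSubgroup.mem_addSubgroupOf, hψapply]
    exact AddSubgroup.torsionBy.nsmul_iff.symm
  have h := AddSubgroup.card_mul_index ψ.ker
  rw [AddSubgroup.index_ker, hrange, hker, Nat.card_congr (AddSubgroup.addSubgroupOfEquivOfLe hle).toEquiv] at h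
  rw [← h, mul_comm]

/-- **`#Pic[3ⁿ] = (#J[λ])^{2n}`** for `y³ = f(x)`, `3 ∤ deg f`, over `K̄ ∋ ζ₃`, when `Pic⁰(C_{f,K̄})` is
`3`-divisible. [cite: RosenFunctionFields2002, Ch. 11, Thm. 11.12] [cite: Zarhin2018SuperellipticJacobians, §8] -/
theorem geomPic_card_torsionBy_pow_of_divisible (hζ : IsPrimitiveRoot ζ 3) (hsep : f.Separable) (hndvd : ¬ 3 ∣ f.natDegree)
    (hdiv : ∀ c : GeomPic K 3 f, SuperellipticPic.degree K (AlgebraicClosure K) 3 f c = 0 →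
      ∃ c' : GeomPic K 3 f, 3 • c' = c) {r : ℕ} (hlam : Nat.card (geomLambdaTorsion K 3 f) = 3 ^ r) (n : ℕ) :
    Nat.card (AddSubgroup.torsionBy (GeomPic K 3 f) (3 ^ n : ℕ)) = 3 ^ (2 * r * n) := by
  induction n with
  | zero =>
    simp only [mul_zero, pow_zero]
    haveI : Subsingleton (AddSubgroup.torsionBy (GeomPic K 3 f) (1 : ℕ)) := by
      refine ⟨fun x y => Subtype.ext ?_⟩
      have hx : ((1 : ℕ) • (x : GeomPic K 3 f)) = 0 := AddSubgroup.torsionBy.nsmul_iff.1 x.2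
      have hy : ((1 : ℕ) • (y : GeomPic K 3 f)) = 0 := AddSubgroup.torsionBy.nsmul_iff.1 y.2
      rw [one_nsmul] at hx hy
      rw [hx, hy]
    exact Nat.card_unique
  | succ n ih =>
    rw [geomPic_card_torsionBy_pow_succ_of_divisible hdiv n, ih, geomPic_card_torsionBy_three_eq_sq hζ hsep hndvd hdiv, hlam, ← pow_mul, ← pow_add]
    congr 1
    ring

end Divisible

/-! ### The Picard curve: `#J_f[3ⁿ] = 3^{6n}` from divisibility -/

section PicardCount

variable (K : Type) [Field K] [CharZero K] [IsCyclotomicExtension {3} ℚ K]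

/-- **`#J_f[3ⁿ] = 3^{6n}` for the Picard curve `y³ = f(x)` over `K̄`, `K ⊇ ℚ(ω)`, from `3`-divisibility of
`Pic⁰(C_{f,K̄})`** (`#J_f[1 - ω] = 27`, `picard_card_geomLambdaTorsion`, and `geomPic_card_torsionBy_pow_of_divisible`):
the rank-`6` input of Upton's construction, reduced to Rosen Thm. 11.12 (i) for the one function field
`K̄(C_f)`. [cite: Upton2009, §2] [cite: RosenFunctionFields2002, Ch. 11, Thm. 11.12] -/
theorem picard_hcard_of_divisible (f : ℤ[X]) (h4 : f.natDegree = 4) (hsep : (f.map (Int.castRingHom ℚ)).Separable)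
    (hdiv : haveI := fact_irreducible_superellipticPoly_picard K h4 hsep
      ∀ c : GeomPic K 3 (f.map (algebraMap ℤ K)),
        SuperellipticPic.degree K (AlgebraicClosure K) 3 (f.map (algebraMap ℤ K)) c = 0 →
          ∃ c' : GeomPic K 3 (f.map (algebraMap ℤ K)), 3 • c' = c) :
    haveI := fact_irreducible_superellipticPoly_picard K h4 hsep
    ∀ n, Nat.card (AddSubgroup.torsionBy (GeomPic K 3 (f.map (algebraMap ℤ K))) (3 ^ n : ℕ)) = 3 ^ (2 * 3 * n) := by
  haveI := fact_irreducible_superellipticPoly_picard K h4 hsep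
  exact geomPic_card_torsionBy_pow_of_divisible (isPrimitiveRoot_zeta3 K) (separable_map_algebraMap_int K hsep)
    (not_three_dvd_natDegree_map K h4) hdiv (picard_card_geomLambdaTorsion K f h4 hsep)

/-- The same from the general divisibility of divisor class groups over algebraically closed constant
fields (Rosen Thm. 11.12 (i)), applied to `K̄(C_f)` and `N = 3`. [cite: RosenFunctionFields2002, Ch. 11, Thm. 11.12] -/
theorem picard_hcard_of_divisorClass_divisible
    (hX1' : ∀ (M : Type) (F : Type) [Field M] [Field F] [Algebra M F] [IsAlgClosed M] [IsAlgFunctionField M F]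
      (N : ℕ), (N : M) ≠ 0 → ∀ c : DivisorClass M F, DivisorClass.degree (K := M) (F := F) c = 0 →
        ∃ c' : DivisorClass M F, N • c' = c)
    (f : ℤ[X]) (h4 : f.natDegree = 4) (hsep : (f.map (Int.castRingHom ℚ)).Separable) :
    haveI := fact_irreducible_superellipticPoly_picard K h4 hsep
    ∀ n, Nat.card (AddSubgroup.torsionBy (GeomPic K 3 (f.map (algebraMap ℤ K))) (3 ^ n : ℕ)) = 3 ^ (2 * 3 * n) := by
  haveI := fact_irreducible_superellipticPoly_picard K h4 hsep
  refine picard_hcard_of_divisible K f h4 hsep fun c hc => ?_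
  exact hX1' (AlgebraicClosure K) (SuperellipticFunctionField K (AlgebraicClosure K) 3 (f.map (algebraMap ℤ K))) 3
    three_ne_zero c hc

end PicardCount

/-! ### The special fibre without `hX1`: counts transported along the good-reduction datum -/

section PicardLocal

variable (K : Type) [Field K] [NumberField K] [IsCyclotomicExtension {3} ℚ K]
variable (f : ℤ[X]) [hf4 : Fact (f.natDegree = 4)] [hfs : Fact (f.map (Int.castRingHom ℚ)).Separable]

attribute [local instance] fact_irreducible_picard_inst picardEisensteinModule picard_isScalarTower_inst
  picard_smulCommClass_inst

variable {K f}

variable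
  (hX2 : ∀ (K : Type) [Field K] [NumberField K] (p : ℕ) [Fact p.Prime] (f : K[X]) (f₀ : (𝓞 K)[X]),
    f₀.map (algebraMap (𝓞 K) K) = f →
    ∀ (𝔭 : HeightOneSpectrum (𝓞 K)) (𝔓 : Ideal (absIntegers (𝓞 K) K)) [𝔓.IsMaximal] [𝔓.LiesOver 𝔭.asIdeal],
    (p : 𝓞 K) ∉ 𝔭.asIdeal → ¬ p ∣ f.natDegree →
    (f₀.map (Ideal.Quotient.mk 𝔭.asIdeal)).natDegree = f.natDegree →
    (f₀.map (Ideal.Quotient.mk 𝔭.asIdeal)).Separable →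
    ∀ [Fact (Irreducible (superellipticPoly K (AlgebraicClosure K) p f))]
      [Fact (Irreducible (superellipticPoly (𝓞 K ⧸ 𝔭.asIdeal) (absIntegers (𝓞 K) K ⧸ 𝔓) p
        (f₀.map (Ideal.Quotient.mk 𝔭.asIdeal))))],
    ∃ red : GeomPic K p f →+
        SuperellipticPic (𝓞 K ⧸ 𝔭.asIdeal) (absIntegers (𝓞 K) K ⧸ 𝔓) p (f₀.map (Ideal.Quotient.mk 𝔭.asIdeal)),
      (∀ (τ : MulAction.stabilizer (absoluteGaloisGroup K) 𝔓) (c : GeomPic K p f),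
          red ((τ : absoluteGaloisGroup K) • c) =
            (Ideal.Quotient.stabilizerHom 𝔓 𝔭.asIdeal (absoluteGaloisGroup K) τ) • red c) ∧
      (∀ (ζ : CyclicCoverDeck (AlgebraicClosure K) p) (c : GeomPic K p f),
          red (ζ • c) = CyclicCoverDeck.reduceMod K p 𝔓 ζ • red c) ∧
      (∀ N : ℕ, (N : 𝓞 K ⧸ 𝔭.asIdeal) ≠ 0 →
        (∀ c : GeomPic K p f, N • c = 0 → red c = 0 → c = 0) ∧
        (∀ c', N • c' = 0 → ∃ c : GeomPic K p f, N • c = 0 ∧ red c = c')))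
  (hX3 : ∀ (k : Type) [Field k] [Fintype k] (Ω : Type) [Field Ω] [Algebra k Ω] [IsAlgClosed Ω]
    [Algebra.IsAlgebraic k Ω] (p : ℕ) [Fact p.Prime] (ℓ : ℕ) [Fact ℓ.Prime] (f : k[X]),
    (p : k) ≠ 0 → (ℓ : k) ≠ 0 → f.Separable → ¬ p ∣ f.natDegree →
    ∀ [Fact (Irreducible (superellipticPoly k Ω p f))] (φ : Ω ≃ₐ[k] Ω), (∀ x : Ω, φ x = x ^ Fintype.card k) →
    ∀ (ξ : CyclicCoverDeck Ω p),
      LinearMap.trace ℚ_[ℓ] (RationalTateModule (SuperellipticPic k Ω p f) ℓ)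
        (rationalTateRepresentation (Ω ≃ₐ[k] Ω) (SuperellipticPic k Ω p f) ℓ φ ∘ₗ
          rationalTateRepresentation (CyclicCoverDeck Ω p) (SuperellipticPic k Ω p f) ℓ ξ) =
        (Fintype.card k : ℚ_[ℓ]) + 1 -
          Nat.card {P : PlaceOver Ω (SuperellipticFunctionField k Ω p f) // φ • (ξ • P) = P})

section GoodPrime

variable {𝔭 : HeightOneSpectrum (𝓞 K)} (h3𝔭 : (3 : 𝓞 K) ∉ 𝔭.asIdeal)
  (hdeg𝔭 : (f.map ((Ideal.Quotient.mk 𝔭.asIdeal).comp (algebraMap ℤ (𝓞 K)))).natDegree = 4)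
  (hsep𝔭 : (f.map ((Ideal.Quotient.mk 𝔭.asIdeal).comp (algebraMap ℤ (𝓞 K)))).Separable)
  {𝔓 : Ideal (absIntegers (𝓞 K) K)} [𝔓.IsMaximal] [h𝔓over : 𝔓.LiesOver 𝔭.asIdeal]

omit [IsCyclotomicExtension {3} ℚ K] in
include hX2 h3𝔭 hdeg𝔭 hsep𝔭 in
/-- **The good-reduction datum for the Picard curve at `𝔭 ∤ 3` of good reduction, with BOTH halves of the
torsion clause** (injective and surjective on `3`-power torsion). [cite: SerreTate1968GoodReduction, §1, Lemma 2 and Thm. 1] -/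
theorem picard_exists_reduction_bij :
    haveI := fact_irreducible_reduction_inst (K := K) (f := f) hdeg𝔭 hsep𝔭 (𝔓 := 𝔓)
    ∃ red : GeomPic K 3 (f.map (algebraMap ℤ K)) →+
        SuperellipticPic (𝓞 K ⧸ 𝔭.asIdeal) (absIntegers (𝓞 K) K ⧸ 𝔓) 3
          ((f.map (algebraMap ℤ (𝓞 K))).map (Ideal.Quotient.mk 𝔭.asIdeal)),
      (∀ (τ : MulAction.stabilizer (absoluteGaloisGroup K) 𝔓) (c : GeomPic K 3 (f.map (algebraMap ℤ K))),
          red ((τ : absoluteGaloisGroup K) • c) =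
            (Ideal.Quotient.stabilizerHom 𝔓 𝔭.asIdeal (absoluteGaloisGroup K) τ) • red c) ∧
      (∀ (ζ : CyclicCoverDeck (AlgebraicClosure K) 3) (c : GeomPic K 3 (f.map (algebraMap ℤ K))),
          red (ζ • c) = CyclicCoverDeck.reduceMod K 3 𝔓 ζ • red c) ∧
      (∀ (n : ℕ) (c : GeomPic K 3 (f.map (algebraMap ℤ K))), 3 ^ n • c = 0 → red c = 0 → c = 0) ∧
      (∀ (n : ℕ) c', 3 ^ n • c' = 0 → ∃ c : GeomPic K 3 (f.map (algebraMap ℤ K)), 3 ^ n • c = 0 ∧ red c = c') := by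
  haveI := fact_irreducible_reduction_inst (K := K) (f := f) hdeg𝔭 hsep𝔭 (𝔓 := 𝔓)
  haveI : Fact (Nat.Prime 3) := ⟨Nat.prime_three⟩
  obtain ⟨red, hτ, hζ, hN⟩ := hX2 K 3 (f.map (algebraMap ℤ K)) (f.map (algebraMap ℤ (𝓞 K)))
    (map_map_algebraMap_ringOfIntegers K f) 𝔭 𝔓 (by exact_mod_cast h3𝔭) (not_three_dvd_natDegree_map K hf4.out)
    (by rw [map_map_mk_ringOfIntegers, hdeg𝔭, natDegree_map_algebraMap_int_eq K hf4.out])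
    (by rw [map_map_mk_ringOfIntegers]; exact hsep𝔭)
  have h3n : ∀ n : ℕ, ((3 ^ n : ℕ) : 𝓞 K ⧸ 𝔭.asIdeal) ≠ 0 := fun n => by
    rw [Nat.cast_pow]
    exact pow_ne_zero n (three_ne_zero_residue h3𝔭)
  exact ⟨red, hτ, hζ, fun n c h3c hc => (hN (3 ^ n) (h3n n)).1 c h3c hc, fun n c' hc' => (hN (3 ^ n) (h3n n)).2 c' hc'⟩

omit [IsCyclotomicExtension {3} ℚ K] in
include hX2 h3𝔭 hdeg𝔭 hsep𝔭 in
/-- **The special fibre has the same torsion counts as the generic fibre**: `#Pic(C̄)[3ⁿ] = #J_f[3ⁿ]`,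
the good-reduction datum being bijective on `3`-power torsion (Serre–Tate §1 Lemma 2) — so the
structure theorem `hX1` is not needed on the special fibre. [cite: SerreTate1968GoodReduction, §1, Lemma 2] -/
theorem card_torsionBy_reduction_eq (n : ℕ) :
    haveI := fact_irreducible_reduction_inst (K := K) (f := f) hdeg𝔭 hsep𝔭 (𝔓 := 𝔓)
    Nat.card (AddSubgroup.torsionBy (SuperellipticPic (𝓞 K ⧸ 𝔭.asIdeal) (absIntegers (𝓞 K) K ⧸ 𝔓) 3
      ((f.map (algebraMap ℤ (𝓞 K))).map (Ideal.Quotient.mk 𝔭.asIdeal))) (3 ^ n : ℕ)) =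
      Nat.card (AddSubgroup.torsionBy (GeomPic K 3 (f.map (algebraMap ℤ K))) (3 ^ n : ℕ)) := by
  haveI := fact_irreducible_reduction_inst (K := K) (f := f) hdeg𝔭 hsep𝔭 (𝔓 := 𝔓)
  obtain ⟨red, -, -, hinj, hsurj⟩ := picard_exists_reduction_bij (K := K) (f := f) hX2 h3𝔭 hdeg𝔭 hsep𝔭 (𝔓 := 𝔓)
  symm
  refine Nat.card_congr (Equiv.ofBijective
    (fun c => ⟨red c, AddSubgroup.torsionBy.nsmul_iff.2 (by
      rw [← map_nsmul, AddSubgroup.torsionBy.nsmul_iff.1 c.2, map_zero])⟩) ⟨?_, ?_⟩)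
  · rintro ⟨c₁, hc₁⟩ ⟨c₂, hc₂⟩ h
    have h' : red (c₁ - c₂) = 0 := by
      rw [map_sub, sub_eq_zero]
      exact congrArg Subtype.val h
    have h3 : 3 ^ n • (c₁ - c₂) = 0 := by
      rw [smul_sub, AddSubgroup.torsionBy.nsmul_iff.1 hc₁, AddSubgroup.torsionBy.nsmul_iff.1 hc₂, sub_self]
    exact Subtype.ext (sub_eq_zero.1 (hinj n _ h3 h'))
  · rintro ⟨c', hc'⟩
    obtain ⟨c, hc, hcc'⟩ := hsurj n c' (AddSubgroup.torsionBy.nsmul_iff.1 hc')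
    exact ⟨⟨c, AddSubgroup.torsionBy.nsmul_iff.2 hc⟩, Subtype.ext hcc'⟩

include hX2 hX3 h3𝔭 hdeg𝔭 hsep𝔭 in
set_option maxHeartbeats 800000 in
/-- **`tr_{ℤ₃}(τ δ^i | T₃ J(C_f))` at a Frobenius `τ` is the twisted point count** — the theorem
`picard_trace_frob_deck` of `PicardLambdaAdicRepLocal` run from the count `#J_f[3ⁿ] = 3^{6n}` (`hcard`)
instead of `hX1`: the count of the special fibre is transported along the bijective reduction datum
(`card_torsionBy_reduction_eq`); then transfer of traces (`trace_eq_of_injective_of_comp_eq`), the twisted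
Lefschetz trace formula (`hX3`), fixed places of `Frob ∘ δ̄^i` (`card_fixedPlaces_frobenius_deck`) and
cubic character sums (`picard_twistedCount_eq_characterSum`), verbatim.
[cite: Upton2009, §2] [cite: Milne1986JacobianVarieties, §11 Prop. 11.2] -/
theorem picard_trace_frob_deck_of_card
    (hcard : ∀ n, Nat.card (AddSubgroup.torsionBy (GeomPic K 3 (f.map (algebraMap ℤ K))) (3 ^ n : ℕ)) = 3 ^ (2 * 3 * n))
    (τ : absoluteGaloisGroup K) (hτ : IsArithFrobAt (𝓞 K) τ 𝔓) {i : ℕ} (hi : i < 3) :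
    ∃ m : ℤ,
      LinearMap.trace ℤ_[3] _
        (DistribSMul.toLinearMap ℤ_[3] (TateModule (GeomPic K 3 (f.map (algebraMap ℤ K))) 3) τ ∘ₗ
          DistribSMul.toLinearMap ℤ_[3] (TateModule (GeomPic K 3 (f.map (algebraMap ℤ K))) 3)
            (deckGen (isPrimitiveRoot_zeta3 K) ^ i)) = m ∧
      (m : 𝓞 K) = (zeta3Int K ^ i) ^ 2 * picardTrace f 𝔭 + zeta3Int K ^ i * picardTrace (f ^ 2) 𝔭 := by
  classical
  haveI : Fact (Nat.Prime 3) := ⟨Nat.prime_three⟩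
  haveI := fact_irreducible_reduction_inst (K := K) (f := f) hdeg𝔭 hsep𝔭 (𝔓 := 𝔓)
  letI : Fintype (𝓞 K ⧸ 𝔭.asIdeal) := Fintype.ofFinite (𝓞 K ⧸ 𝔭.asIdeal)
  haveI : IsAlgClosed (absIntegers (𝓞 K) K ⧸ 𝔓) := absIntegers.isAlgClosed_quotient 𝔓
  haveI : Algebra.IsAlgebraic (𝓞 K ⧸ 𝔭.asIdeal) (absIntegers (𝓞 K) K ⧸ 𝔓) := inferInstance
  have hfb' : ((f.map (algebraMap ℤ (𝓞 K))).map (Ideal.Quotient.mk 𝔭.asIdeal)) = f.map ((Ideal.Quotient.mk 𝔭.asIdeal).comp (algebraMap ℤ (𝓞 K))) :=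
    map_map_mk_ringOfIntegers K f 𝔭
  have h3k : (3 : (𝓞 K ⧸ 𝔭.asIdeal)) ≠ 0 := three_ne_zero_residue h3𝔭
  have hq : Fintype.card (𝓞 K ⧸ 𝔭.asIdeal) = 𝔭.residueCard := by
    rw [HeightOneSpectrum.residueCard_eq_card_quotient, Nat.card_eq_fintype_card]
  have hdegb : ((f.map (algebraMap ℤ (𝓞 K))).map (Ideal.Quotient.mk 𝔭.asIdeal)).natDegree = 4 := by rw [hfb']; exact hdeg𝔭
  have hsepb : ((f.map (algebraMap ℤ (𝓞 K))).map (Ideal.Quotient.mk 𝔭.asIdeal)).Separable := by rw [hfb']; exact hsep𝔭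
  have hndvdb : ¬ 3 ∣ ((f.map (algebraMap ℤ (𝓞 K))).map (Ideal.Quotient.mk 𝔭.asIdeal)).natDegree := by rw [hdegb]; decide
  have hpq : 3 ∣ Fintype.card (𝓞 K ⧸ 𝔭.asIdeal) - 1 := by
    rw [hq]; exact three_dvd_residueCard_sub_one (isPrimitiveRoot_zeta3Int K) h3𝔭
  -- the reduction datum and ranks (special fibre count from the bijection, not from `hX1`)
  obtain ⟨red, hredτ, hredζ, hinj⟩ := picard_exists_reduction (K := K) (f := f) hX2 h3𝔭 hdeg𝔭 hsep𝔭 (𝔓 := 𝔓)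
  have hcard' : ∀ n, Nat.card (AddSubgroup.torsionBy (SuperellipticPic (𝓞 K ⧸ 𝔭.asIdeal) (absIntegers (𝓞 K) K ⧸ 𝔓) 3
      ((f.map (algebraMap ℤ (𝓞 K))).map (Ideal.Quotient.mk 𝔭.asIdeal))) (3 ^ n : ℕ)) = 3 ^ (2 * 3 * n) := fun n => by
    rw [card_torsionBy_reduction_eq (K := K) (f := f) hX2 h3𝔭 hdeg𝔭 hsep𝔭 (𝔓 := 𝔓) n, hcard n]
  haveI := TateModule.free_of_card_torsionBy_rank hcard
  haveI := TateModule.finite_of_card_torsionBy_rank hcard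
  haveI := TateModule.free_of_card_torsionBy_rank hcard'
  haveI := TateModule.finite_of_card_torsionBy_rank hcard'
  have hrank : Module.finrank ℤ_[3] (TateModule (GeomPic K 3 (f.map (algebraMap ℤ K))) 3) =
      Module.finrank ℤ_[3] (TateModule (SuperellipticPic (𝓞 K ⧸ 𝔭.asIdeal) (absIntegers (𝓞 K) K ⧸ 𝔓) 3 ((f.map (algebraMap ℤ (𝓞 K))).map (Ideal.Quotient.mk 𝔭.asIdeal))) 3) := by
    rw [TateModule.finrank_eq_of_card_torsionBy hcard, TateModule.finrank_eq_of_card_torsionBy hcard']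
  -- the Frobenius automorphism of `κ(𝔓)` and the reduced deck transformation
  set φ : (absIntegers (𝓞 K) K ⧸ 𝔓) ≃ₐ[(𝓞 K ⧸ 𝔭.asIdeal)] (absIntegers (𝓞 K) K ⧸ 𝔓) :=
    Ideal.Quotient.stabilizerHom 𝔓 𝔭.asIdeal (absoluteGaloisGroup K) ⟨τ, hτ.mem_stabilizer⟩ with hφdef
  have hφ : ∀ x : (absIntegers (𝓞 K) K ⧸ 𝔓), φ x = x ^ Fintype.card (𝓞 K ⧸ 𝔭.asIdeal) := stabilizerHom_apply_eq_pow (K := K) τ hτ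
  set ξ : CyclicCoverDeck (absIntegers (𝓞 K) K ⧸ 𝔓) 3 := CyclicCoverDeck.reduceMod K 3 𝔓 (deckGen (isPrimitiveRoot_zeta3 K) ^ i) with hξdef
  -- transfer of the trace to the special fibre
  have htransfer : LinearMap.trace ℤ_[3] _
      (DistribSMul.toLinearMap ℤ_[3] (TateModule (GeomPic K 3 (f.map (algebraMap ℤ K))) 3) τ ∘ₗ
        DistribSMul.toLinearMap ℤ_[3] (TateModule (GeomPic K 3 (f.map (algebraMap ℤ K))) 3)
          (deckGen (isPrimitiveRoot_zeta3 K) ^ i)) =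
      LinearMap.trace ℤ_[3] _
        (DistribSMul.toLinearMap ℤ_[3] (TateModule (SuperellipticPic (𝓞 K ⧸ 𝔭.asIdeal) (absIntegers (𝓞 K) K ⧸ 𝔓) 3 ((f.map (algebraMap ℤ (𝓞 K))).map (Ideal.Quotient.mk 𝔭.asIdeal))) 3) φ ∘ₗ
          DistribSMul.toLinearMap ℤ_[3] (TateModule (SuperellipticPic (𝓞 K ⧸ 𝔭.asIdeal) (absIntegers (𝓞 K) K ⧸ 𝔓) 3 ((f.map (algebraMap ℤ (𝓞 K))).map (Ideal.Quotient.mk 𝔭.asIdeal))) 3) ξ) :=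
    trace_eq_of_injective_of_comp_eq hrank (TateModule.map 3 red)
      (TateModule.map_injective_of_forall_torsionBy red hinj) _ _
      (TateModule.map_comp_toLinearMap_eq red τ φ (fun c => hredτ ⟨τ, hτ.mem_stabilizer⟩ c) _ ξ
        (fun c => hredζ _ c))
  -- twisted Lefschetz on `V₃` of the special fibre
  have hlef := hX3 (𝓞 K ⧸ 𝔭.asIdeal) (absIntegers (𝓞 K) K ⧸ 𝔓) 3 3 ((f.map (algebraMap ℤ (𝓞 K))).map (Ideal.Quotient.mk 𝔭.asIdeal)) (by exact_mod_cast h3k) (by exact_mod_cast h3k) hsepb hndvdb φ hφ ξ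
  rw [trace_rationalTateRepresentation_comp] at hlef
  -- the fixed places of `Frob ∘ δ̄^i`
  have hfix := SuperellipticFunctionField.card_fixedPlaces_frobenius_deck (k := (𝓞 K ⧸ 𝔭.asIdeal)) (Ω := (absIntegers (𝓞 K) K ⧸ 𝔓)) (p := 3) (f := ((f.map (algebraMap ℤ (𝓞 K))).map (Ideal.Quotient.mk 𝔭.asIdeal))) φ hφ
    (by exact_mod_cast h3k) hsepb hndvdb hpq ξ
  -- the label condition in the two spellings
  have hξval : ξ.val = algebraMap (𝓞 K ⧸ 𝔭.asIdeal) (absIntegers (𝓞 K) K ⧸ 𝔓) (Ideal.Quotient.mk 𝔭.asIdeal (zeta3Int K ^ i)) :=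
    val_reduceMod_deckGen_pow (K := K) (𝔓 := 𝔓) i
  have hfilter : (Finset.univ.filter fun a : (𝓞 K ⧸ 𝔭.asIdeal) => ((f.map (algebraMap ℤ (𝓞 K))).map (Ideal.Quotient.mk 𝔭.asIdeal)).eval a ≠ 0 ∧
      algebraMap (𝓞 K ⧸ 𝔭.asIdeal) (absIntegers (𝓞 K) K ⧸ 𝔓) (((f.map (algebraMap ℤ (𝓞 K))).map (Ideal.Quotient.mk 𝔭.asIdeal)).eval a) ^ ((Fintype.card (𝓞 K ⧸ 𝔭.asIdeal) - 1) / 3) = ξ.val) =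
      (Finset.univ.filter fun a : (𝓞 K ⧸ 𝔭.asIdeal) =>
        (f.map ((Ideal.Quotient.mk 𝔭.asIdeal).comp (algebraMap ℤ (𝓞 K)))).eval a ≠ 0 ∧
          Ideal.Quotient.mk 𝔭.asIdeal (zeta3Int K ^ i) =
            (f.map ((Ideal.Quotient.mk 𝔭.asIdeal).comp (algebraMap ℤ (𝓞 K)))).eval a ^ ((𝔭.residueCard - 1) / 3)) := by
    refine Finset.filter_congr fun a _ => ?_
    rw [hfb', hξval, ← map_pow, hq]
    exact and_congr_right fun _ => ⟨fun h => ((algebraMap (𝓞 K ⧸ 𝔭.asIdeal) (absIntegers (𝓞 K) K ⧸ 𝔓)).injective h).symm,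
      fun h => congrArg (algebraMap (𝓞 K ⧸ 𝔭.asIdeal) (absIntegers (𝓞 K) K ⧸ 𝔓)) h.symm⟩
  have hfilter0 : (Finset.univ.filter fun a : (𝓞 K ⧸ 𝔭.asIdeal) => ((f.map (algebraMap ℤ (𝓞 K))).map (Ideal.Quotient.mk 𝔭.asIdeal)).eval a = 0) =
      (Finset.univ.filter fun a : (𝓞 K ⧸ 𝔭.asIdeal) =>
        (f.map ((Ideal.Quotient.mk 𝔭.asIdeal).comp (algebraMap ℤ (𝓞 K)))).eval a = 0) := by
    rw [hfb']
  -- the character sum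
  have hchar := picard_twistedCount_eq_characterSum (isPrimitiveRoot_zeta3Int K) h3𝔭 f hi
  -- assemble
  refine ⟨(Fintype.card (𝓞 K ⧸ 𝔭.asIdeal) : ℤ) + 1 -
    (Nat.card {P : PlaceOver (absIntegers (𝓞 K) K ⧸ 𝔓) (SuperellipticFunctionField (𝓞 K ⧸ 𝔭.asIdeal) (absIntegers (𝓞 K) K ⧸ 𝔓) 3 ((f.map (algebraMap ℤ (𝓞 K))).map (Ideal.Quotient.mk 𝔭.asIdeal))) // φ • (ξ • P) = P} : ℕ), ?_, ?_⟩
  · apply IsFractionRing.injective ℤ_[3] ℚ_[3]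
    rw [htransfer, hlef]
    simp only [map_sub, map_add, map_natCast, map_one, Int.cast_sub, Int.cast_add, Int.cast_natCast,
      Int.cast_one]
  · rw [hfix, hfilter, hfilter0, ← hchar]
    push_cast
    ring

end GoodPrime

/-! ### The Frobenius trace of `ρ₁`, from the count -/

include hX2 hX3 in
/-- **The geometric Frobenius has trace `j(a_𝔭(f))` on `ρ = ρ₁^∨`**: for `ρ₁` built with `u = j(ω)²`,
`τ` an arithmetic Frobenius at `𝔓 ∣ 𝔭` (`𝔭 ∤ 3` of good reduction) and `ρ = ρ₁^∨` the dual,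
`tr ρ(τ⁻¹) = tr ρ₁(τ) = j(a_𝔭(f))` — the FROBENIUS TRACE clause of `picardCurve_exists_lambdaAdicRep`, from
the count `hcard` instead of `hX1` (`picard_trace_frob_deck_of_card`; then the nondegenerate `2 × 2` system
`X + Y = m₀`, `uX + u²Y = m₁` against `j(a) + j(a') = m₀`, `u j(a) + u² j(a') = m₁` as in
`trace_picardRho1_frob`). [cite: Upton2009, §2, Thm. 2.1] -/
theorem trace_dual_picardRho1_frob_inv_of_card
    (hcard : ∀ n, Nat.card (AddSubgroup.torsionBy (GeomPic K 3 (f.map (algebraMap ℤ K))) (3 ^ n : ℕ)) = 3 ^ (2 * 3 * n))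
    (b : Module.Basis (Fin 3) PadicEisenstein (TateModule (GeomPic K 3 (f.map (algebraMap ℤ K))) 3))
    (j : K →+* PadicAlgCl 3) (hu : (j (zeta3 K) ^ 2) ^ 2 + j (zeta3 K) ^ 2 + 1 = 0)
    {𝔭 : HeightOneSpectrum (𝓞 K)} (h3𝔭 : (3 : 𝓞 K) ∉ 𝔭.asIdeal)
    (hdeg𝔭 : (f.map ((Ideal.Quotient.mk 𝔭.asIdeal).comp (algebraMap ℤ (𝓞 K)))).natDegree = 4)
    (hsep𝔭 : (f.map ((Ideal.Quotient.mk 𝔭.asIdeal).comp (algebraMap ℤ (𝓞 K)))).Separable)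
    {𝔓 : Ideal (absIntegers (𝓞 K) K)} (h𝔓 : 𝔓 ∈ 𝔭.primesAbove)
    (τ : absoluteGaloisGroup K) (hτ : IsArithFrobAt (𝓞 K) τ 𝔓) :
    FramedRep.trace (FramedRep.dual (picardRho1 hcard b (j (zeta3 K) ^ 2) hu)) τ⁻¹ = j (picardTrace f 𝔭 : K) := by
  rw [FramedRep.trace_dual, inv_inv]
  haveI := HeightOneSpectrum.isMaximal_of_mem_primesAbove h𝔓
  haveI : 𝔓.LiesOver 𝔭.asIdeal := h𝔓.2
  set v := j (zeta3 K) with hv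
  set u := v ^ 2 with hudef
  have hv3 : v ^ 3 = 1 := by rw [hv, ← map_pow, (isPrimitiveRoot_zeta3 K).pow_eq_one, map_one]
  have hv1 : v ≠ 1 := by
    rw [hv, Ne, ← map_one j, j.injective.eq_iff]
    exact (isPrimitiveRoot_zeta3 K).ne_one (by norm_num)
  have hu' : (u ^ 2) ^ 2 + u ^ 2 + 1 = 0 := sq_sq_add_sq_add_one hu
  have hu2v : u ^ 2 = v := by rw [hudef]; linear_combination v * hv3
  -- the two integers `m₀, m₁`
  obtain ⟨m₀, hm₀, hm₀'⟩ := picard_trace_frob_deck_of_card (K := K) (f := f) hX2 hX3 h3𝔭 hdeg𝔭 hsep𝔭 (𝔓 := 𝔓) hcard τ hτ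
    (i := 0) (by norm_num)
  obtain ⟨m₁, hm₁, hm₁'⟩ := picard_trace_frob_deck_of_card (K := K) (f := f) hX2 hX3 h3𝔭 hdeg𝔭 hsep𝔭 (𝔓 := 𝔓) hcard τ hτ
    (i := 1) (by norm_num)
  rw [trace_frob_deck_eq_algebraTrace b τ] at hm₀ hm₁
  rw [pow_zero, one_mul] at hm₀
  rw [pow_one] at hm₁
  -- `A = tr_O(τ | T)`, `X = σ(A)`, `Y = σ̄(A)`
  set A : PadicEisenstein := LinearMap.trace PadicEisenstein _
    (DistribMulAction.toModuleEnd PadicEisenstein (TateModule (GeomPic K 3 (f.map (algebraMap ℤ K))) 3) τ) with hA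
  rw [trace_picardRho1 hcard b u hu τ]
  -- `X + Y = m₀`, `u X + u² Y = m₁`
  have e0 := lift_add_lift_sq_eq_algebraMap_trace u hu hu' A
  have e1 := lift_add_lift_sq_eq_algebraMap_trace u hu hu' (PadicEisenstein.omega * A)
  rw [hm₀, map_intCast] at e0
  rw [hm₁, map_intCast, map_mul, map_mul, PadicEisenstein.lift_omega, PadicEisenstein.lift_omega] at e1
  -- `j a + j a' = m₀`, `v² j a + v j a' = m₁`
  set J : 𝓞 K →+* PadicAlgCl 3 := j.comp (algebraMap (𝓞 K) K) with hJ
  have hJζ : J (zeta3Int K) = v := rfl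
  have e0' := congrArg J hm₀'
  have e1' := congrArg J hm₁'
  simp only [pow_zero, one_pow, one_mul, pow_one, map_add, map_mul, map_pow, map_intCast, hJζ] at e0' e1'
  change PadicEisenstein.lift u hu A = J (picardTrace f 𝔭)
  -- solve the `2 × 2` system
  have hv0 : v ≠ 0 := by
    rintro h0; rw [h0] at hv3; norm_num at hv3
  have hvv : v ^ 2 - v ≠ 0 := by
    rw [show v ^ 2 - v = v * (v - 1) by ring]
    exact mul_ne_zero hv0 (sub_ne_zero.2 hv1)
  have key : (v ^ 2 - v) * (PadicEisenstein.lift u hu A - J (picardTrace f 𝔭)) = 0 := by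
    linear_combination e1 + e1' - v * (e0 + e0') - (PadicEisenstein.lift u hu A) * hudef -
      (PadicEisenstein.lift (u ^ 2) hu' A) * hu2v
  exact sub_eq_zero.1 ((mul_eq_zero.1 key).resolve_left hvv)

end PicardLocal

/-! ### The theorem, from the count / from divisibility -/

attribute [local instance] fact_irreducible_picard_inst picardEisensteinModule picard_isScalarTower_inst
  picard_smulCommClass_inst

/-- **Galois representations attached to Picard curves** (Upton 2009, Thm. 2.1 / §4), conditional form
with the rank input made explicit as a COUNT: GIVEN (`hcardK`) `#J_f[3ⁿ] = 3^{6n}` for the Picard curves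
over `K̄`, `K ⊇ ℚ(ω)` of characteristic `0` (e.g. from Rosen Cor. 11.12, or from divisibility of `Pic⁰` via
`picard_hcard_of_divisible`; stated for all such `K` so that no `ℤ`-algebra diamond on `CyclotomicField 3 ℚ`
enters the hypothesis),
(`hX2`) the good-reduction datum for `y^p = f(x)` at the primes `𝔭 ∤ p` where `f mod 𝔭` stays separable
of the same degree (Serre–Tate §1 Lemma 2 / Thm. 1; Deuring) and (`hX3`) the twisted Lefschetz trace
formula (Milne JV §11 Prop. 11.2 with `α = π ∘ ξ`), the statement `picardCurve_exists_lambdaAdicRep` holds,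
with `ρ = ρ₁^∨` as in `picardCurve_exists_lambdaAdicRep_of_torsion_goodReduction_lefschetz`.
[cite: Upton2009, Thm. 2.1 and §4] [cite: SerreTate1968GoodReduction, §1, Thm. 1]
[cite: Milne1986JacobianVarieties, §11 Prop. 11.2] -/
theorem picardCurve_exists_lambdaAdicRep_of_card_goodReduction_lefschetz
    (hcardK : ∀ (K : Type) [Field K] [CharZero K] [IsCyclotomicExtension {3} ℚ K]
      (f : ℤ[X]) (h4 : f.natDegree = 4) (hsep : (f.map (Int.castRingHom ℚ)).Separable),
      haveI := fact_irreducible_superellipticPoly_picard K h4 hsep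
      ∀ n, Nat.card (AddSubgroup.torsionBy (GeomPic K 3 (f.map (algebraMap ℤ K))) (3 ^ n : ℕ)) = 3 ^ (2 * 3 * n))
    (hX2 : ∀ (K : Type) [Field K] [NumberField K] (p : ℕ) [Fact p.Prime] (f : K[X]) (f₀ : (𝓞 K)[X]),
      f₀.map (algebraMap (𝓞 K) K) = f →
      ∀ (𝔭 : HeightOneSpectrum (𝓞 K)) (𝔓 : Ideal (absIntegers (𝓞 K) K)) [𝔓.IsMaximal] [𝔓.LiesOver 𝔭.asIdeal],
      (p : 𝓞 K) ∉ 𝔭.asIdeal → ¬ p ∣ f.natDegree →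
      (f₀.map (Ideal.Quotient.mk 𝔭.asIdeal)).natDegree = f.natDegree →
      (f₀.map (Ideal.Quotient.mk 𝔭.asIdeal)).Separable →
      ∀ [Fact (Irreducible (superellipticPoly K (AlgebraicClosure K) p f))]
        [Fact (Irreducible (superellipticPoly (𝓞 K ⧸ 𝔭.asIdeal) (absIntegers (𝓞 K) K ⧸ 𝔓) p
          (f₀.map (Ideal.Quotient.mk 𝔭.asIdeal))))],
      ∃ red : GeomPic K p f →+
          SuperellipticPic (𝓞 K ⧸ 𝔭.asIdeal) (absIntegers (𝓞 K) K ⧸ 𝔓) p (f₀.map (Ideal.Quotient.mk 𝔭.asIdeal)),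
        (∀ (τ : MulAction.stabilizer (absoluteGaloisGroup K) 𝔓) (c : GeomPic K p f),
            red ((τ : absoluteGaloisGroup K) • c) =
              (Ideal.Quotient.stabilizerHom 𝔓 𝔭.asIdeal (absoluteGaloisGroup K) τ) • red c) ∧
        (∀ (ζ : CyclicCoverDeck (AlgebraicClosure K) p) (c : GeomPic K p f),
            red (ζ • c) = CyclicCoverDeck.reduceMod K p 𝔓 ζ • red c) ∧
        (∀ N : ℕ, (N : 𝓞 K ⧸ 𝔭.asIdeal) ≠ 0 →
          (∀ c : GeomPic K p f, N • c = 0 → red c = 0 → c = 0) ∧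
          (∀ c', N • c' = 0 → ∃ c : GeomPic K p f, N • c = 0 ∧ red c = c')))
    (hX3 : ∀ (k : Type) [Field k] [Fintype k] (Ω : Type) [Field Ω] [Algebra k Ω] [IsAlgClosed Ω]
      [Algebra.IsAlgebraic k Ω] (p : ℕ) [Fact p.Prime] (ℓ : ℕ) [Fact ℓ.Prime] (f : k[X]),
      (p : k) ≠ 0 → (ℓ : k) ≠ 0 → f.Separable → ¬ p ∣ f.natDegree →
      ∀ [Fact (Irreducible (superellipticPoly k Ω p f))] (φ : Ω ≃ₐ[k] Ω), (∀ x : Ω, φ x = x ^ Fintype.card k) →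
      ∀ (ξ : CyclicCoverDeck Ω p),
        LinearMap.trace ℚ_[ℓ] (RationalTateModule (SuperellipticPic k Ω p f) ℓ)
          (rationalTateRepresentation (Ω ≃ₐ[k] Ω) (SuperellipticPic k Ω p f) ℓ φ ∘ₗ
            rationalTateRepresentation (CyclicCoverDeck Ω p) (SuperellipticPic k Ω p f) ℓ ξ) =
          (Fintype.card k : ℚ_[ℓ]) + 1 -
            Nat.card {P : PlaceOver Ω (SuperellipticFunctionField k Ω p f) // φ • (ξ • P) = P}) :
    picardCurve_exists_lambdaAdicRep := by
  intro f h4 hsep j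
  classical
  haveI : IsCyclotomicExtension {3} ℚ (CyclotomicField 3 ℚ) := CyclotomicField.isCyclotomicExtension 3 ℚ
  haveI hf4 : Fact (f.natDegree = 4) := ⟨h4⟩
  haveI hfs : Fact (f.map (Int.castRingHom ℚ)).Separable := ⟨hsep⟩
  -- `#J_f[3ⁿ] = 3^{6n}` (from `hcardK`) and a `ℤ₃[ω]`-basis adapted to `J[λ] ≅ (𝔽₃^{roots})⁰`
  have hcard := hcardK (CyclotomicField 3 ℚ) f h4 hsep
  obtain ⟨r₀, b, hb⟩ := picard_exists_basis_repr_smul_congr (CyclotomicField 3 ℚ) f h4 hsep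
    (isPrimitiveRoot_zeta3 (CyclotomicField 3 ℚ)) hcard
  have hR4 : Fintype.card ((f.map (algebraMap ℤ (CyclotomicField 3 ℚ))).rootSet (AlgebraicClosure (CyclotomicField 3 ℚ))) = 4 :=
    card_rootSet_map_algebraMap_int (CyclotomicField 3 ℚ) h4 hsep
  have hι : Fintype.card {y : (f.map (algebraMap ℤ (CyclotomicField 3 ℚ))).rootSet
      (AlgebraicClosure (CyclotomicField 3 ℚ)) // y ≠ r₀} = 3 := by
    rw [Fintype.card_subtype_compl, hR4, Fintype.card_subtype_eq]
  set e := Fintype.equivFinOfCardEq hι with he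
  -- `u = j(ω)²`, the other primitive cube root of unity of `ℚ̄₃`
  have hv : j (zeta3 (CyclotomicField 3 ℚ)) ^ 2 + j (zeta3 (CyclotomicField 3 ℚ)) + 1 = 0 := by
    set v := j (zeta3 (CyclotomicField 3 ℚ)) with hvdef
    have hv3 : v ^ 3 = 1 := by
      rw [hvdef, ← map_pow, (isPrimitiveRoot_zeta3 (CyclotomicField 3 ℚ)).pow_eq_one, map_one]
    have hv1 : v ≠ 1 := by
      rw [hvdef, Ne, ← map_one j, j.injective.eq_iff]
      exact (isPrimitiveRoot_zeta3 (CyclotomicField 3 ℚ)).ne_one (by norm_num)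
    have h : (v - 1) * (v ^ 2 + v + 1) = 0 := by linear_combination hv3
    rcases mul_eq_zero.1 h with h | h
    · exact absurd (sub_eq_zero.1 h) hv1
    · exact h
  have hu : (j (zeta3 (CyclotomicField 3 ℚ)) ^ 2) ^ 2 + j (zeta3 (CyclotomicField 3 ℚ)) ^ 2 + 1 = 0 :=
    sq_sq_add_sq_add_one hv
  -- `ρ = ρ₁^∨`
  refine ⟨FramedRep.dual (picardRho1 hcard (b.reindex e) (j (zeta3 (CyclotomicField 3 ℚ)) ^ 2) hu), ?_, ?_⟩
  · intro 𝔭 h3 hdeg𝔭 hsep𝔭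
    refine ⟨(FramedGaloisRep.isUnramifiedAt_dual_iff 𝔭 _).2
      (picardRho1_isUnramifiedAt (K := CyclotomicField 3 ℚ) (f := f) hX2 h3 hdeg𝔭 hsep𝔭 hcard _ _ hu), ?_⟩
    intro 𝔓 h𝔓 τ hτ
    exact trace_dual_picardRho1_frob_inv_of_card (K := CyclotomicField 3 ℚ) (f := f) hX2 hX3 hcard _ j hu h3 hdeg𝔭 hsep𝔭
      h𝔓 τ hτ
  · intro h12
    exact (picardRho1_isAbsolutelyIrreducible (K := CyclotomicField 3 ℚ) (f := f) hcard h12 e b hb _ hu).dual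

/-- **Galois representations attached to Picard curves** (Upton 2009, Thm. 2.1 / §4), conditional on
DIVISIBILITY instead of the torsion structure: GIVEN (`hX1'`) that the degree-zero divisor class group
`Cl⁰(F/M)` of a function field over an algebraically closed constant field is divisible by every `N`
prime to the characteristic (Rosen, *Number Theory in Function Fields*, Thm. 11.12 (first assertion):
"`J = Cl⁰_K` is a divisible group"; Mumford, *Abelian Varieties* §6 Appl. 2), (`hX2`) the good-reduction
datum for `y^p = f(x)` (Serre–Tate §1 Lemma 2 / Thm. 1; Deuring) and (`hX3`) the twisted Lefschetz trace
formula (Milne JV §11 Prop. 11.2), the statement `picardCurve_exists_lambdaAdicRep` holds.  Compared with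
`picardCurve_exists_lambdaAdicRep_of_torsion_goodReduction_lefschetz` the first input no longer contains
the rank `2g` (Weil): the rank `6` of `T₃ J(C_f)` comes from `#J_f[1 - ω] = 27` (Schaefer–Zarhin, in the
tree) and `λ² = -3ω`.
[cite: Upton2009, Thm. 2.1 and §4] [cite: RosenFunctionFields2002, Ch. 11, Thm. 11.12]
[cite: MumfordAV1970, §6 Application 2] [cite: SerreTate1968GoodReduction, §1, Thm. 1]
[cite: Milne1986JacobianVarieties, §11 Prop. 11.2] -/
theorem picardCurve_exists_lambdaAdicRep_of_divisible_goodReduction_lefschetz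
    (hX1' : ∀ (M : Type) (F : Type) [Field M] [Field F] [Algebra M F] [IsAlgClosed M] [IsAlgFunctionField M F]
      (N : ℕ), (N : M) ≠ 0 → ∀ c : DivisorClass M F, DivisorClass.degree (K := M) (F := F) c = 0 →
        ∃ c' : DivisorClass M F, N • c' = c)
    (hX2 : ∀ (K : Type) [Field K] [NumberField K] (p : ℕ) [Fact p.Prime] (f : K[X]) (f₀ : (𝓞 K)[X]),
      f₀.map (algebraMap (𝓞 K) K) = f →
      ∀ (𝔭 : HeightOneSpectrum (𝓞 K)) (𝔓 : Ideal (absIntegers (𝓞 K) K)) [𝔓.IsMaximal] [𝔓.LiesOver 𝔭.asIdeal],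
      (p : 𝓞 K) ∉ 𝔭.asIdeal → ¬ p ∣ f.natDegree →
      (f₀.map (Ideal.Quotient.mk 𝔭.asIdeal)).natDegree = f.natDegree →
      (f₀.map (Ideal.Quotient.mk 𝔭.asIdeal)).Separable →
      ∀ [Fact (Irreducible (superellipticPoly K (AlgebraicClosure K) p f))]
        [Fact (Irreducible (superellipticPoly (𝓞 K ⧸ 𝔭.asIdeal) (absIntegers (𝓞 K) K ⧸ 𝔓) p
          (f₀.map (Ideal.Quotient.mk 𝔭.asIdeal))))],
      ∃ red : GeomPic K p f →+
          SuperellipticPic (𝓞 K ⧸ 𝔭.asIdeal) (absIntegers (𝓞 K) K ⧸ 𝔓) p (f₀.map (Ideal.Quotient.mk 𝔭.asIdeal)),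
        (∀ (τ : MulAction.stabilizer (absoluteGaloisGroup K) 𝔓) (c : GeomPic K p f),
            red ((τ : absoluteGaloisGroup K) • c) =
              (Ideal.Quotient.stabilizerHom 𝔓 𝔭.asIdeal (absoluteGaloisGroup K) τ) • red c) ∧
        (∀ (ζ : CyclicCoverDeck (AlgebraicClosure K) p) (c : GeomPic K p f),
            red (ζ • c) = CyclicCoverDeck.reduceMod K p 𝔓 ζ • red c) ∧
        (∀ N : ℕ, (N : 𝓞 K ⧸ 𝔭.asIdeal) ≠ 0 →
          (∀ c : GeomPic K p f, N • c = 0 → red c = 0 → c = 0) ∧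
          (∀ c', N • c' = 0 → ∃ c : GeomPic K p f, N • c = 0 ∧ red c = c')))
    (hX3 : ∀ (k : Type) [Field k] [Fintype k] (Ω : Type) [Field Ω] [Algebra k Ω] [IsAlgClosed Ω]
      [Algebra.IsAlgebraic k Ω] (p : ℕ) [Fact p.Prime] (ℓ : ℕ) [Fact ℓ.Prime] (f : k[X]),
      (p : k) ≠ 0 → (ℓ : k) ≠ 0 → f.Separable → ¬ p ∣ f.natDegree →
      ∀ [Fact (Irreducible (superellipticPoly k Ω p f))] (φ : Ω ≃ₐ[k] Ω), (∀ x : Ω, φ x = x ^ Fintype.card k) →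
      ∀ (ξ : CyclicCoverDeck Ω p),
        LinearMap.trace ℚ_[ℓ] (RationalTateModule (SuperellipticPic k Ω p f) ℓ)
          (rationalTateRepresentation (Ω ≃ₐ[k] Ω) (SuperellipticPic k Ω p f) ℓ φ ∘ₗ
            rationalTateRepresentation (CyclicCoverDeck Ω p) (SuperellipticPic k Ω p f) ℓ ξ) =
          (Fintype.card k : ℚ_[ℓ]) + 1 -
            Nat.card {P : PlaceOver Ω (SuperellipticFunctionField k Ω p f) // φ • (ξ • P) = P}) :
    picardCurve_exists_lambdaAdicRep :=
  picardCurve_exists_lambdaAdicRep_of_card_goodReduction_lefschetz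
    (fun K _ _ _ f h4 hsep => picard_hcard_of_divisorClass_divisible K hX1' f h4 hsep) hX2 hX3

end Literature.NumberTheory.GaloisRepresentations
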